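import Summits.Ventures.CertifiedManyBodySolver.Rows.CorrWindowCertKernelForm
import Summits.Ventures.CertifiedManyBodySolver.Rows.CorrWindowCertDictionaryEnergy
import HarnessLib

/-!
# STEP-0 OF «TIER P» ON THE OBS PIPELINE: a window certificate replayed IN THE KERNEL end to end — the Pauli row
# `⟨n_{0↑}⟩_ω ≤ 1` for EVERY torus-limit ground state of the `t–t'` Hubbard model at the La214-E station `(t, t', U) = (1, −3/10, 29/5)`,
# from the one-factor SOS certificate `1 − n_{0↑} = a_{0↑} a†_{0↑}`, with ZERO hypotheses and NO claim node

HONEST FRAMING: a TOY — the bound (`⟨n⟩ ≤ 1`) is trivial physics; the point is the PIPELINE: syntactic certificate data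
(`CARPolyWindow.residT`) → the quantum-chemistry cell's verified CAR normal-orderer (`CARPoly.normalize`, which here has to
discover `a a† = 1 − a†a`) → `lowerConst` evaluated by `decide` → `affineOrbitLowerRowN_of_kernelCert` with BOTH dictionaries
(`termOp_hamTermsIdx`, `termOp_energyTermsIdx`) on the `3 × 3` window → the claim-node predicate
`SquareTTPrimeCorrAffineOrbitLowerRowN` → the plain torus-limit statement. Every hypothesis of the kernel-form theorem is
discharged here (window geometry, letter maps, injectivity / covering of the site enumeration, the decidable inequality); the
trust base is the Lean kernel (std axioms; no `native_decide`). No number of record moves; no existing claim node is discharged;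
CONTROL/CALIBRATION context (wording (xx1)); silent on ρ_s = 0 / presence / T_c / phase; nothing about La₂CuO₄; no summit
statement is proved by this file. Seat hubbard-obs-p2 (STIFFNESS), `prover-hubbard-obs-p2-g22-0`, zero compute.

References: J. Wang et al., PRX 14 (2024) 031006 §III [WangEtAl2024]; X. Han, arXiv:2006.06002 §3 [Han2020Bootstrap].
-/

noncomputable section

namespace Summit.Ventures.CertifiedManyBodySolver

namespace CARPolyWindow

namespace Toy3x3

open Summit.Ventures.CertifiedQuantumChemistry Summit.Ventures.CertifiedQuantumChemistry.CARPoly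
open Literature.MathematicalPhysics.QuantumLattice Literature.MathematicalPhysics.QuantumLattice.HubbardWave0
open Literature.MathematicalPhysics.QuantumManyBody.StateRelaxation
open Literature.Probability.LatticeModels ThermodynamicLimit Filter Topology
open Matrix
open scoped ComplexOrder BigOperators

/-! ## The `3 × 3` window and its indexed letters -/

/-- The `3 × 3` window around the origin (the smallest admissible `Λ'`). [cite: Han2020Bootstrap, §3] -/
abbrev W : Finset (Site 2) := thicken ({0} : Finset (Site 2)) 1

/-- The site enumeration of `W` (origin, `±e₀`, `±e₁`, `±(1,1)`, `±(1,−1)`), as integer vectors. [folklore] -/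
def xs : Fin 9 → Site 2 :=
  ![![0, 0], ![1, 0], ![0, 1], ![-1, 0], ![0, -1], ![1, 1], ![-1, -1], ![1, -1], ![-1, 1]]

/-- The index reader (inverse of `xs` on `W`; junk `0` elsewhere). [folklore] -/
def ix (v : Site 2) : Fin 9 :=
  if v = xs 0 then 0 else if v = xs 1 then 1 else if v = xs 2 then 2 else if v = xs 3 then 3 else if v = xs 4 then 4
  else if v = xs 5 then 5 else if v = xs 6 then 6 else if v = xs 7 then 7 else if v = xs 8 then 8 else 0

/-- `xs 0 = 0`. [folklore] -/
theorem xs_zero : xs 0 = 0 := by funext j; fin_cases j <;> rfl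
/-- `xs 1 = e₀`. [folklore] -/
theorem xs_one : xs 1 = unitVec 0 := by funext j; fin_cases j <;> simp [xs, unitVec]
/-- `xs 2 = e₁`. [folklore] -/
theorem xs_two : xs 2 = unitVec 1 := by funext j; fin_cases j <;> simp [xs, unitVec]
/-- `xs 3 = −e₀`. [folklore] -/
theorem xs_three : xs 3 = -unitVec 0 := by funext j; fin_cases j <;> simp [xs, unitVec]
/-- `xs 4 = −e₁`. [folklore] -/
theorem xs_four : xs 4 = -unitVec 1 := by funext j; fin_cases j <;> simp [xs, unitVec]
/-- `xs 5 = j₀`. [folklore] -/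
theorem xs_five : xs 5 = diagVec 0 := by funext j; fin_cases j <;> simp [xs, diagVec]
/-- `xs 6 = −j₀`. [folklore] -/
theorem xs_six : xs 6 = -diagVec 0 := by funext j; fin_cases j <;> simp [xs, diagVec]
/-- `xs 7 = j₁`. [folklore] -/
theorem xs_seven : xs 7 = diagVec 1 := by funext j; fin_cases j <;> simp [xs, diagVec]
/-- `xs 8 = −j₁`. [folklore] -/
theorem xs_eight : xs 8 = -diagVec 1 := by funext j; fin_cases j <;> simp [xs, diagVec]

/-- Every enumerated site lies in `W`. [folklore] -/
theorem xs_mem (i : Fin 9) : xs i ∈ W := by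
  fin_cases i
  · exact xs_zero ▸ zero_mem_thicken_zero 1
  · exact xs_one ▸ unitVec_mem_thicken_one 0
  · exact xs_two ▸ unitVec_mem_thicken_one 1
  · exact xs_three ▸ neg_unitVec_mem_thicken_one 0
  · exact xs_four ▸ neg_unitVec_mem_thicken_one 1
  · exact xs_five ▸ diagVec_mem_thicken_one 0
  · exact xs_six ▸ neg_diagVec_mem_thicken_one 0
  · exact xs_seven ▸ diagVec_mem_thicken_one 1
  · exact xs_eight ▸ neg_diagVec_mem_thicken_one 1

/-- The enumeration is injective (decided on the integer vectors). [folklore] -/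
theorem xs_injective : Function.Injective xs := by decide

/-- The enumeration covers `W = {−1,0,1}²`. [folklore] -/
theorem xs_cover (y : Site 2) (hy : y ∈ W) : ∃ i, xs i = y := by
  simp only [thicken, Finset.mem_biUnion, Finset.mem_image, Finset.mem_singleton] at hy
  obtain ⟨s, hs, w, hw, rfl⟩ := hy
  subst hs
  rw [Nat.floor_one, mem_box] at hw
  have h0 := hw 0
  have h1 := hw 1
  have hw' : w = ![w 0, w 1] := by funext j; fin_cases j <;> rfl
  rw [zero_add, hw']
  push_cast at h0 h1
  rcases h0 with ⟨h0a, h0b⟩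
  rcases h1 with ⟨h1a, h1b⟩
  interval_cases (w 0) <;> interval_cases (w 1)
  · exact ⟨6, by decide⟩
  · exact ⟨3, by decide⟩
  · exact ⟨8, by decide⟩
  · exact ⟨4, by decide⟩
  · exact ⟨0, by decide⟩
  · exact ⟨2, by decide⟩
  · exact ⟨7, by decide⟩
  · exact ⟨1, by decide⟩
  · exact ⟨5, by decide⟩

/-- The index reader inverts the enumeration. [folklore] -/
theorem xs_ix (i : Fin 9) : xs (ix (xs i)) = xs i := by fin_cases i <;> decide

/-- Hence `xs (ix v) = v` on `W`. [folklore] -/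
theorem xs_ix_of_mem (v : Site 2) (hv : v ∈ W) : xs (ix v) = v := by
  obtain ⟨i, rfl⟩ := xs_cover v hv
  exact xs_ix i

/-- The letter map: index letters `Orb (Fin 9)` → orbitals of `W`. [folklore] -/
def d (p : Orb (Fin 9)) : Orb (PolySite W) := orb (PolySite.pt (xs (ofLex p).1) (xs_mem (ofLex p).1)) (ofLex p).2

/-- `d (i, σ) = (xs i, σ)`. [folklore] -/
theorem d_orb (i : Fin 9) (σ : Fin 2) : d (orb i σ) = orb (PolySite.pt (xs i) (xs_mem i)) σ := rfl

/-- The letter map is injective. [folklore] -/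
theorem d_injective : Function.Injective d := by
  intro p q h
  have h' : (PolySite.pt (xs (ofLex p).1) (xs_mem (ofLex p).1), (ofLex p).2) =
      (PolySite.pt (xs (ofLex q).1) (xs_mem (ofLex q).1), (ofLex q).2) := congrArg ofLex h
  obtain ⟨hpt, hσ⟩ := Prod.mk.inj h'
  have hx : xs (ofLex p).1 = xs (ofLex q).1 := by
    have := congrArg (fun z : PolySite W => ofLex z.1) hpt
    simpa using this
  have hi : (ofLex p).1 = (ofLex q).1 := xs_injective hx
  have : ofLex p = ofLex q := Prod.ext hi hσ
  exact congrArg toLex this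

/-- Membership-proof irrelevance for ordered sites. [folklore] -/
private theorem pt_congr_site' {x y : Site 2} (hx : x ∈ W) (hy : y ∈ W) (h : x = y) :
    PolySite.pt x hx = PolySite.pt y hy := by
  subst h; rfl

/-- The packed sort key of a letter. [folklore] -/
def enc (p : Orb (Fin 9)) : ℕ := 2 * ((ofLex p).1 : ℕ) + ((ofLex p).2 : ℕ)

/-! ## The certificate: `1 − n_{0↑} = a_{0↑} a†_{0↑}` (one SOS factor `a†_{0↑}`) -/

/-- The objective `1 − n_{0↑}`. [folklore] -/
def TX : Terms (Orb (Fin 9)) := [([], 1), ([(orb (ix 0) 0, true), (orb (ix 0) 0, false)], -1)]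

/-- The single SOS factor `a†_{0↑}` (so the Gram part is `(a†)† a† = a a† = 1 − a†a`). [folklore] -/
def Q : List (Terms (Orb (Fin 9))) := [[([(orb (ix 0) 0, true)], 1)]]

/-- The window Hamiltonian term list at `(t, t', U) = (1, −3/10, 29/5)` (enters only through the empty eom family). [folklore] -/
def TH : Terms (Orb (Fin 9)) := hamTermsIdx 1 (-3 / 10) (29 / 5) xs

/-- The mean-energy term list at `(1, −3/10, 29/5)` (enters with multipliers `κhi = κlo = 0`). [folklore] -/
def TE : Terms (Orb (Fin 9)) := energyTermsIdx 1 (-3 / 10) (29 / 5) ix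

/-- The residual of the toy certificate (no density rows, no energy rows, one SOS factor, no eom / symmetry / charged /
anti-Hermitian families). [cite: WangEtAl2024, §III] -/
def toyResid : Terms (Orb (Fin 9)) :=
  residT TX (fun _ => 0) 0 (fun σ => orb (ix 0) σ) 0 0 0 0 TE 0 Q TH (fun b : Fin 0 => b.elim0) []
    (fun l : Fin 0 => l.elim0) (fun l : Fin 0 => l.elim0) [] []

/-- **The kernel evaluation**: the collected normal form of the toy residual has `lowerConst ≥ 0` (in fact `= 0`: the
normal-orderer finds `1 − n − a a† = 0`). Decided by the kernel. [cite: WangEtAl2024, §III] -/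
theorem toy_lowerConst : (0 : ℚ) ≤ lowerConst (CARPoly.normalize enc 32 toyResid) + (0 + 0) * ((7 / 8 : ℚ) / 2 - 0) := by
  decide +kernel

/-! ## The end-to-end theorem -/

/-- **STEP-0 of tier P (toy): the affine-N claim-node predicate for the objective `1 − n_{0↑}` at the La214-E station
`(1, −3/10, 29/5)`, value `0`, no energy slope, from the kernel-replayed certificate — ZERO hypotheses.**
[cite: WangEtAl2024, §III] -/
theorem toy_affineOrbitLowerRowN :
    SquareTTPrimeCorrAffineOrbitLowerRowN (((-3 / 10 : ℚ)) : ℝ) (((29 / 5 : ℚ)) : ℝ) 0 0 0 0 0 0 (7 / 8) {1} W (termOp d TX) := by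
  have hz : (0 : Site 2) ∈ W := zero_mem_thicken_zero 1
  have h1 : (1 : DihedralGroup 4) ∈ ({1} : Finset (DihedralGroup 4)) := Finset.mem_singleton_self 1
  have hmul : ∀ a ∈ ({1} : Finset (DihedralGroup 4)), ∀ b ∈ ({1} : Finset (DihedralGroup 4)),
      a * b ∈ ({1} : Finset (DihedralGroup 4)) := by
    intro a ha b hb
    rw [Finset.mem_singleton] at ha hb ⊢
    rw [ha, hb, mul_one]
  have hΛ : ({0} : Finset (Site 2)) ⊆ W := Finset.singleton_subset_iff.2 hz
  have hix0 : xs (ix 0) = 0 := xs_ix_of_mem 0 hz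
  have ho : ∀ σ : Fin 2, d (orb (ix 0) σ) = orb (PolySite.pt 0 hz) σ := by
    intro σ
    rw [d_orb, pt_congr_site' (xs_mem (ix 0)) hz hix0]
  have hH : termOp d TH = (hubbardTTPrimeFermionInteraction 1 (((-3 / 10 : ℚ)) : ℝ) (((29 / 5 : ℚ)) : ℝ)).localHamiltonian W := by
    rw [TH, termOp_hamTermsIdx 1 (-3 / 10) (29 / 5) xs xs_mem xs_injective xs_cover d d_orb, Rat.cast_one]
  have hE : termOp d TE = fermionEmbed (PolySite.incl (subset_refl W))
      ((hubbardTTPrimeFermionInteraction 1 (((-3 / 10 : ℚ)) : ℝ) (((29 / 5 : ℚ)) : ℝ)).meanEnergyObs 1) := by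
    rw [TE, termOp_energyTermsIdx 1 (-3 / 10) (29 / 5) xs xs_mem (subset_refl W) ix xs_ix_of_mem d d_orb, Rat.cast_one]
  exact affineOrbitLowerRowN_of_kernelCert (-3 / 10) (29 / 5) (by norm_num) hΛ (subset_refl W) (subset_refl W) hz h1 hmul
    d d_injective enc 32 (fun b : Fin 0 => b.elim0) (fun b : Fin 0 => b.elim0) (fun b => b.elim0)
    (fun p => (ofLex p).2) (fun _ => rfl) TH hH TE hE (fun σ => orb (ix 0) σ) ho TX (fun _ => 0) 0 0 0 0 0 0 Q []
    (fun l : Fin 0 => l.elim0) (fun l => l.elim0) (fun l : Fin 0 => l.elim0) (fun l : Fin 0 => l.elim0)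
    (fun l => l.elim0) (fun l => l.elim0) (fun l : Fin 0 => l.elim0) [] (fun wc hwc => absurd hwc (List.not_mem_nil)) []
    (by norm_num) toy_lowerConst

/-- The objective IS `1 − n_{0↑}`. [folklore] -/
theorem termOp_TX : termOp d TX = 1 - nAt 0 (zero_mem_thicken_zero 1) 0 := by
  have hz : (0 : Site 2) ∈ W := zero_mem_thicken_zero 1
  rw [TX, termOp_cons, termOp_cons, termOp_nil, add_zero, Rat.cast_one, one_smul, Rat.cast_neg, Rat.cast_one, neg_one_smul,
    ← sub_eq_add_neg]
  have hix0 : xs (ix 0) = 0 := xs_ix_of_mem 0 hz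
  have ho : d (orb (ix 0) 0) = orb (PolySite.pt 0 hz) 0 := by
    rw [d_orb, pt_congr_site' (xs_mem (ix 0)) hz hix0]
  have hw0 : wmap d ([] : List (Orb (Fin 9) × Bool)) = [] := rfl
  have hw1 : wmap d [(orb (ix 0) 0, true), (orb (ix 0) 0, false)] = [(d (orb (ix 0) 0), true), (d (orb (ix 0) 0), false)] := rfl
  rw [hw0, hw1, ho, ladderWord_nil, ladderWord_cons, ladderWord_cons, ladderWord_nil, mul_one]
  congr 1

/-- **THE PAULI ROW, KERNEL-REPLAYED**: for every density `x ∈ [0, 2)` and every torus limit `ω` of unit sector ground states of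
`hubbardTorusTT' L 1 (−3/10) (29/5)` along `L → ∞`: `0 ≤ Re ω(1 − n_{0↑})`, i.e. `Re ω(n_{0↑}) ≤ 1` — obtained from the one-factor
SOS certificate through the whole kernel-form pipeline, no hypothesis, no claim node. [cite: WangEtAl2024, §III] -/
theorem toy_pauli_row (x : ℝ) (hx0 : 0 ≤ x) (hx2 : x < 2) (ω : InfVolFermionState 2) (Ls : ℕ → ℕ)
    (ψ : ∀ L, Fock (Orb (FermionTorus 2 L))) (hLs : Tendsto Ls atTop atTop)
    (hψ : ∀ j, IsGroundStateInSector (hubbardTorusTT' (Ls j) 1 (((-3 / 10 : ℚ)) : ℝ) (((29 / 5 : ℚ)) : ℝ)) (rectN x (Ls j)) 0 (ψ (Ls j)))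
    (hψ1 : ∀ j, star (ψ (Ls j)) ⬝ᵥ ψ (Ls j) = 1) (hω : ω.IsTorusLimitOf ψ Ls) :
    0 ≤ (ω.expect W (1 - nAt 0 (zero_mem_thicken_zero 1) 0)).re := by
  have h := toy_affineOrbitLowerRowN x hx0 hx2 ω Ls ψ hLs hψ hψ1 hω
  rw [termOp_TX, Finset.sum_singleton, Finset.card_singleton, Nat.cast_one, inv_one, one_mul,
    ω.expect_fermionEmbed_d4Emb_one_zero] at h
  push_cast at h
  linarith

end Toy3x3

end CARPolyWindow

end Summit.Ventures.CertifiedManyBodySolver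

end
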